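import Summits.CriticalPhenomena.Ising3DConformalLimit.Theses.FKParityRobustness
import Summits.CriticalPhenomena.Ising3DConformalLimit.Theorems.FKParityRobustnessLatticeBoundFromStrands
import Summits.CriticalPhenomena.Ising3DConformalLimit.Theorems.FKParityRobustnessFarMergingGivesU4
import Summits.CriticalPhenomena.Ising3DConformalLimit.Theorems.FKParityRobustnessIndependentStrandsJoinStubTransfer
import Summits.CriticalPhenomena.Ising3DConformalLimit.Theorems.FKParityRobustnessIndependentStrandsJoinStubSeparation
import Summits.CriticalPhenomena.Ising3DConformalLimit.Theorems.FKParityRobustnessIndependentStrandsJoinStubSymmetry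
import Summits.CriticalPhenomena.Ising3DConformalLimit.Theorems.FKParityRobustnessIndependentStrandsJoinStubBoxSymmetry
import Summits.CriticalPhenomena.Ising3DConformalLimit.Theorems.FKParityRobustnessIndependentStrandsJoinStubPairSplit
import Summits.CriticalPhenomena.Ising3DConformalLimit.Theorems.FKParityRobustnessDepletionBound
import Summits.CriticalPhenomena.Ising3DConformalLimit.Theorems.FKParityRobustnessDepletionBoundHTE
import Summits.CriticalPhenomena.Ising3DConformalLimit.Theorems.FKParityRobustnessDefs
import Summits.CriticalPhenomena.Ising3DConformalLimit.Theorems.FKParityRobustnessStrandsJoinBound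
import Literature.Probability.LatticeModels.HighDimPointwiseTriviality
import Literature.Probability.LatticeModels.CriticalTwoPointBounds
import HarnessLib

/-!
# `IndependentStrandsJoin` ⟸ (existence of the pointwise limit) ∧ (tetrahedral far merging infinitely often)
# ∧ (per-scale crux) — the limit upgrade, sorry-free
(crux item stmt-CriticalPhenomena-14625, route `FKParityRobustness`; the proved part of the line
`Cruxes/IndependentStrandsJoin/Lines/limit_upgrade_io.lean`, crux strategist p1, 2026-08-17)

Theorem-and-definitions file (`--supports stmt-CriticalPhenomena-14625`).  Posited objects (all `Prop`s /
real-valued abbreviations over tree vocabulary): `U4crit`, `GGcrit` (critical lattice Ursell function and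
pair product at the dilated tetrahedron `l·A`), `LimitExists` (existence + non-degeneracy of a pointwise
scaling limit of `criticalCorr 3`: the existence half of the route crux `MoebiusLimit`), `TetraMergingIO`
(`∃ c > 0, ∀ L₀, ∃ l ≥ L₀, U₄^crit(l·A) ≤ -c·GG` — far merging at the regular tetrahedron along infinitely
many scales), `TetraMergingEventually`, `IndependentStrandsJoinPerScale` (the standing disprover's per-scale
crux, Disproof § A, verbatim).

Results (axioms `propext`, `Classical.choice`, `Quot.sound`):
* `tetraMergingEventually_of_io : LimitExists → TetraMergingIO → TetraMergingEventually` — a convergent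
  sequence (`R₄(A_l)`, convergent because `ρ(1/l)⁴U₄ → U₄(S)` and `ρ(1/l)²⟨σσ⟩ → S₂ > 0`) that is `≥ c`
  infinitely often is eventually `≥ c/2`;
* `boxU4Bound_of_critical` — a strict-margin tetrahedral bound in the critical state passes to all large
  free boxes (`criticalCorr_wellDefined_holds`);
* `jointSum_ge_of_boxU4` — per box, the landed sandwich of line `Sketch`
  (`StubTransfer.joint_ge_of_sep_sym_u4` + `stub_separation/symmetry/boxSymmetry/pairSplit` +
  `depletionBound_proof`) turns it into the crux's joint loop-O(1) inequality with constant `c/3`;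
* `independentStrandsJoin_of_limit_io : LimitExists → TetraMergingIO → IndependentStrandsJoinPerScale →
  IndependentStrandsJoin` — the composition (finitely many small scales patched by the per-scale constants);
* calibration: `limitExists_of_moebiusLimit : MoebiusLimit → LimitExists`,
  `tetraMergingIO_of_independentStrandsJoin : IndependentStrandsJoin → TetraMergingIO`.

So modulo the route's own rank-4 crux the rank-2 crux is equivalent to its `∃^∞ l` weakening: the
`∀ l`-uniformity (Disproof § A's load-bearing structure) is not load-bearing for the route.

References: M. Aizenman, Comm. Math. Phys. 86 (1982) Prop. 5.3 [AizenmanCMP1982]; M. Aizenman,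
H. Duminil-Copin, V. Sidoravicius, Comm. Math. Phys. 334 (2015) (continuity at `β_c`, behind
`criticalCorr_wellDefined_holds`) [AizenmanDuminilCopinSidoraviciusCMP2015]; S. Friedli, Y. Velenik 2017,
§3.7.3 (high-temperature expansion) [FriedliVelenik2017].
-/
noncomputable section

open Filter Topology Finset
open Literature.Probability.LatticeModels
open Summit.CriticalPhenomena.Ising3DConformalLimit.Theses.FKParityRobustness
open Summit.CriticalPhenomena.Ising3DConformalLimit.FKParityRobustnessFarMergingGivesU4
  (injective_vecCons_pair injective_toLp_intCast latticeApprox_inv_natCast)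
open Summit.CriticalPhenomena.Ising3DConformalLimit.FKParityRobustnessLatticeBoundFromStrands
  (connectedFour_boxComap twoPoint_boxComap nPoint_boxComap smul_tetra_mem_box
   twoPoint_eq_loopO1_div twoPoint_eq_isingExpect_spinMonomial)
open Summit.CriticalPhenomena.Ising3DConformalLimit.Cruxes.ParityRobustMerging.PlaquetteXorSurgery
  (tetra tetra_inj tetra_injective tanh_criticalBeta_nonneg)

namespace Summit.CriticalPhenomena.Ising3DConformalLimit.Theorems.IndependentStrandsJoinLimitUpgrade

/-! ## Vocabulary -/

-- `tetra : Fin 4 → Site 3` = the route's tetrahedron `{(−1,−1,−1),(1,1,−1),(1,−1,1),(−1,1,1)}` (landed Defs file,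
-- verbatim the literal of the crux decl's `let tetra`).

/-- The critical lattice Ursell function at the dilated tetrahedron `l·A` (infinite-volume critical state). -/
def U4crit (l : ℕ) : ℝ :=
  criticalCorr 3 4 (fun i => (l : ℤ) • tetra i) -
    (criticalCorr 3 2 ![(l : ℤ) • tetra 0, (l : ℤ) • tetra 1] * criticalCorr 3 2 ![(l : ℤ) • tetra 2, (l : ℤ) • tetra 3] +
      criticalCorr 3 2 ![(l : ℤ) • tetra 0, (l : ℤ) • tetra 2] * criticalCorr 3 2 ![(l : ℤ) • tetra 1, (l : ℤ) • tetra 3] +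
      criticalCorr 3 2 ![(l : ℤ) • tetra 0, (l : ℤ) • tetra 3] * criticalCorr 3 2 ![(l : ℤ) • tetra 1, (l : ℤ) • tetra 2])

/-- The product of the two sourced-pair critical correlations `⟨σ_{la₀}σ_{la₁}⟩⟨σ_{la₂}σ_{la₃}⟩`. -/
def GGcrit (l : ℕ) : ℝ :=
  criticalCorr 3 2 ![(l : ℤ) • tetra 0, (l : ℤ) • tetra 1] * criticalCorr 3 2 ![(l : ℤ) • tetra 2, (l : ℤ) • tetra 3]

/-- **`LimitExists`.** Existence of a non-degenerate pointwise scaling limit of the critical Ising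
correlators on `ℤ³` (renormalisation `ρ > 0` on `(0,1]`).  The existence + non-degeneracy clauses of the
route crux `MoebiusLimit` (item stmt-CriticalPhenomena-1344), nothing about covariance. -/
def LimitExists : Prop :=
  ∃ (ρ : ℝ → ℝ) (S : CorrFamily 3), (∀ δ ∈ Set.Ioc (0:ℝ) 1, 0 < ρ δ) ∧
    HasPointwiseScalingLimit (criticalCorr 3) ρ S ∧ IsNondegenerateTwoPoint S

/-- **`TetraMergingIO`.** Far merging at the regular tetrahedron ALONG INFINITELY MANY
SCALES: `∃ c > 0, ∀ L₀, ∃ l ≥ L₀, U₄^crit(l·A) ≤ -c·⟨σ_{la₀}σ_{la₁}⟩⟨σ_{la₂}σ_{la₃}⟩`. -/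
def TetraMergingIO : Prop :=
  ∃ c : ℝ, 0 < c ∧ ∀ L₀ : ℕ, ∃ l : ℕ, L₀ ≤ l ∧ U4crit l ≤ -(c * GGcrit l)

/-- Far merging at the regular tetrahedron at ALL LARGE scales (intermediate currency). -/
def TetraMergingEventually : Prop :=
  ∃ c : ℝ, 0 < c ∧ ∃ l₁ : ℕ, ∀ l : ℕ, l₁ ≤ l → U4crit l ≤ -(c * GGcrit l)

/-- **`IndependentStrandsJoinPerScale`.** The PER-SCALE crux (`∀ l ≥ 1, ∃ c(l) > 0, …`, everything else verbatim):
the standing disprover's `IndependentStrandsJoinPerScale` (Disproof § A), TRUE with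
`c(l) = (t_c/(1+t_c))^{8l}·t_c^{4l}` by path forcing and XOR transport. -/
def IndependentStrandsJoinPerScale : Prop :=
  let tetra : Fin 4 → Literature.Probability.LatticeModels.Site 3 := ![![-1, -1, -1], ![1, 1, -1], ![1, -1, 1], ![-1, 1, 1]]; ∀ l : ℕ, 1 ≤ l → ∃ c : ℝ, 0 < c ∧ ∃ N₀ : ℕ, ∀ N : ℕ, N₀ ≤ N → ∀ a : Fin 4 → ↥(Literature.Probability.LatticeModels.box 3 N), (∀ i, ((a i : Literature.Probability.LatticeModels.Site 3)) = (l : ℤ) • tetra i) → (let G := ((Literature.Probability.LatticeModels.zdGraph 3).comap (Subtype.val : ↥(Literature.Probability.LatticeModels.box 3 N) → Literature.Probability.LatticeModels.Site 3)); let t : ℝ := Real.tanh (Literature.Probability.LatticeModels.criticalBeta 3); c * Literature.Probability.LatticeModels.loopO1PartitionFunction G t {a 0, a 1} * Literature.Probability.LatticeModels.loopO1PartitionFunction G t {a 2, a 3} ≤ ∑ F₁ ∈ Literature.Probability.LatticeModels.tJoins G Set.univ {a 0, a 1}, ∑ F₂ ∈ Literature.Probability.LatticeModels.tJoins G Set.univ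 {a 2, a 3}, if (SimpleGraph.fromEdgeSet ((↑F₁ : Set (Sym2 ↥(Literature.Probability.LatticeModels.box 3 N))) ∪ ↑F₂)).Reachable (a 0) (a 2) then t ^ (F₁.card + F₂.card) else 0)

/-! ## Step 1 — the limit upgrade: infinitely often ⇒ eventually, under existence of the limit -/

/-- If `f → a` and `f ≤ 0` frequently, then `a ≤ 0`. [folklore] -/
theorem le_zero_of_tendsto_of_frequently {f : ℕ → ℝ} {a : ℝ} (hf : Tendsto f atTop (𝓝 a))
    (hfr : ∃ᶠ n in atTop, f n ≤ 0) : a ≤ 0 := by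
  by_contra h
  push Not at h
  have hev : ∀ᶠ n in atTop, 0 < f n := hf.eventually (lt_mem_nhds h)
  obtain ⟨n, hn1, hn2⟩ := (hfr.and_eventually hev).exists
  exact absurd hn2 (not_lt.2 hn1)

/-- **Limit upgrade.**  Under existence of a non-degenerate pointwise scaling limit, far merging at
the tetrahedron along infinitely many scales holds at ALL large scales (with half the constant):
the ratio `U₄^crit(l·A)/⟨σσ⟩⟨σσ⟩` converges. [folklore] -/
theorem tetraMergingEventually_of_io (hL : LimitExists) (hio : TetraMergingIO) : TetraMergingEventually := by
  obtain ⟨ρ, S, hρ, hlim, hnd⟩ := hL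
  obtain ⟨c, hc, hio⟩ := hio
  -- the continuum configuration `y = A ⊂ ℝ³`, meshes `δ_l = 1/l`
  set y : Fin 4 → EuclideanSpace ℝ (Fin 3) := fun i => WithLp.toLp 2 fun k => ((tetra i k : ℤ) : ℝ) with hy_def
  have hy : Function.Injective y := injective_toLp_intCast tetra_inj
  set δ : ℕ → ℝ := fun l => ((l : ℝ))⁻¹ with hδ_def
  have hδ : Tendsto δ atTop (𝓝[>] (0 : ℝ)) :=
    tendsto_inv_atTop_nhdsGT_zero.comp tendsto_natCast_atTop_atTop
  have hz : ∀ (l : ℕ) (i : Fin 4), latticeApprox (δ l) (y i) = (l : ℤ) • tetra i :=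
    fun l i => latticeApprox_inv_natCast (tetra i) l
  -- convergence of the rescaled four-point and two-point correlators along ALL scales
  have h4 : Tendsto (fun l : ℕ => ρ (δ l) ^ 4 * criticalCorr 3 4 (fun i => (l : ℤ) • tetra i)) atTop
      (𝓝 (S 4 y)) := by
    have hy' : y ∈ NonCoincident 3 4 := hy
    refine (((hlim 4).tendsto_at hy').comp hδ).congr fun l => ?_
    have hzl : (fun i => latticeApprox (δ l) (y i)) = fun i => (l : ℤ) • tetra i := funext (hz l)
    simp only [Function.comp_apply, rescaledCorrelator_apply, hzl]
  have h2 : ∀ a b : Fin 4, a ≠ b →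
      Tendsto (fun l : ℕ => ρ (δ l) ^ 2 * criticalCorr 3 2 ![(l : ℤ) • tetra a, (l : ℤ) • tetra b]) atTop
        (𝓝 (S 2 ![y a, y b])) := by
    intro a b hab
    have hmem : ![y a, y b] ∈ NonCoincident 3 2 := injective_vecCons_pair (hy.ne hab)
    refine (((hlim 2).tendsto_at hmem).comp hδ).congr fun l => ?_
    have hzl : (fun i => latticeApprox (δ l) (![y a, y b] i)) = ![(l : ℤ) • tetra a, (l : ℤ) • tetra b] := by
      funext i
      fin_cases i <;> simp [hz]
    simp only [Function.comp_apply, rescaledCorrelator_apply, hzl]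
  -- the rescaled Ursell function and the rescaled product of pair correlations converge
  set A : ℝ := limitConnectedFour S y with hA
  set B : ℝ := S 2 ![y 0, y 1] * S 2 ![y 2, y 3] with hB
  have hBpos : 0 < B :=
    mul_pos (hnd _ (injective_vecCons_pair (hy.ne (by decide))))
      (hnd _ (injective_vecCons_pair (hy.ne (by decide))))
  have hU : Tendsto (fun l : ℕ => ρ (δ l) ^ 4 * U4crit l) atTop (𝓝 A) := by
    have h := h4.sub ((((h2 0 1 (by decide)).mul (h2 2 3 (by decide))).add
      ((h2 0 2 (by decide)).mul (h2 1 3 (by decide)))).add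
      ((h2 0 3 (by decide)).mul (h2 1 2 (by decide))))
    refine h.congr fun l => ?_
    simp only [U4crit]
    ring
  have hG : Tendsto (fun l : ℕ => ρ (δ l) ^ 4 * GGcrit l) atTop (𝓝 B) := by
    have h := (h2 0 1 (by decide)).mul (h2 2 3 (by decide))
    refine h.congr fun l => ?_
    simp only [GGcrit]
    ring
  -- the io hypothesis, rescaled: frequently `ρ⁴(U₄ + c·GG) ≤ 0`, hence `A + c·B ≤ 0`
  have hfreq : ∃ᶠ l in atTop, ρ (δ l) ^ 4 * U4crit l + c * (ρ (δ l) ^ 4 * GGcrit l) ≤ 0 := by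
    refine Filter.frequently_atTop.2 fun L₀ => ?_
    obtain ⟨l, hl, hle⟩ := hio L₀
    refine ⟨l, hl, ?_⟩
    have hρ4 : 0 ≤ ρ (δ l) ^ 4 := by positivity
    have h0 : U4crit l + c * GGcrit l ≤ 0 := by linarith
    have e : ρ (δ l) ^ 4 * U4crit l + c * (ρ (δ l) ^ 4 * GGcrit l) = ρ (δ l) ^ 4 * (U4crit l + c * GGcrit l) := by
      ring
    rw [e]
    exact mul_nonpos_of_nonneg_of_nonpos hρ4 h0
  have hAB : A + c * B ≤ 0 :=
    le_zero_of_tendsto_of_frequently (hU.add (hG.const_mul c)) hfreq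
  -- hence `A + (c/2)·B < 0`, so eventually `ρ⁴(U₄ + (c/2)·GG) < 0`
  have hneg : A + c / 2 * B < 0 := by nlinarith
  have hev : ∀ᶠ l in atTop, ρ (δ l) ^ 4 * U4crit l + c / 2 * (ρ (δ l) ^ 4 * GGcrit l) < 0 :=
    (hU.add (hG.const_mul (c / 2))).eventually (gt_mem_nhds hneg)
  obtain ⟨l₁, hl₁⟩ := Filter.eventually_atTop.1 (hev.and (Filter.eventually_ge_atTop 1))
  refine ⟨c / 2, by positivity, l₁, fun l hl => ?_⟩
  obtain ⟨hlt, hl1⟩ := hl₁ l hl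
  -- un-rescale: `ρ(1/l) > 0` for `l ≥ 1`
  have hδmem : δ l ∈ Set.Ioc (0:ℝ) 1 := by
    have hl0 : (1 : ℝ) ≤ l := by exact_mod_cast hl1
    refine ⟨by positivity, ?_⟩
    exact inv_le_one_of_one_le₀ hl0
  have hρpos : 0 < ρ (δ l) ^ 4 := pow_pos (hρ _ hδmem) 4
  have key : ρ (δ l) ^ 4 * (U4crit l + c / 2 * GGcrit l) < 0 := by
    have e : ρ (δ l) ^ 4 * (U4crit l + c / 2 * GGcrit l) =
        ρ (δ l) ^ 4 * U4crit l + c / 2 * (ρ (δ l) ^ 4 * GGcrit l) := by ring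
    rw [e]
    exact hlt
  have : U4crit l + c / 2 * GGcrit l < 0 := by
    by_contra hcon
    push Not at hcon
    exact absurd (mul_nonneg hρpos.le hcon) (not_le.2 key)
  linarith

/-! ## Step 2 — infinite volume ⇒ free boxes (per scale) -/

/-- `0 < ⟨σ_aσ_b⟩_{β_c}` on `ℤ³` (Simon–Lieb lower bound `c‖x‖⁻² ≤ ⟨σ₀σ_x⟩`, and `⟨σ₀σ₀⟩ = 1`). [folklore] -/
theorem criticalCorr_two_pos (a b : Site 3) : 0 < criticalCorr 3 2 ![a, b] := by
  rw [criticalCorr_two_pair]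
  by_cases h : b - a = 0
  · rw [h, criticalTwoPoint_zero']
    exact one_pos
  · obtain ⟨c, C, hc, hbd⟩ := criticalTwoPoint_bounds_holds (d := 3) (by norm_num)
    have hn : 0 < (‖b - a‖ : ℝ) := norm_pos_iff.2 h
    exact lt_of_lt_of_le (mul_pos hc (Real.rpow_pos_of_pos hn _)) (hbd _ h).1

/-- The free pair correlation `isingCorr G univ β 0 free {x,y}` of a finite graph is its two-point function
`twoPoint (isingMeasure G univ β 0 free) spinAt x y` (`x ≠ y`): both are `Z^{xy}_t/Z^∅_t`. [folklore] -/
theorem isingCorr_pair_eq_twoPoint {V : Type*} [Fintype V] [DecidableEq V] (G : SimpleGraph V)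
    [DecidableRel G.Adj] {β : ℝ} (hβ : 0 ≤ β) {x y : V} (hxy : x ≠ y) :
    isingCorr G Finset.univ β 0 .free {x, y} = twoPoint (isingMeasure G Finset.univ β 0 .free) spinAt x y := by
  classical
  rw [twoPoint_eq_loopO1_div hβ hxy, isingCorr_free_eq_hteSum_div G Finset.univ β (Finset.subset_univ _),
    ← Summit.CriticalPhenomena.Ising3DConformalLimit.Theorems.DepletionBound.loopO1PartitionFunction_eq_hteSum,
    ← Summit.CriticalPhenomena.Ising3DConformalLimit.Theorems.DepletionBound.loopO1PartitionFunction_eq_hteSum]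

/-- **Infinite volume ⇒ boxes.**  A STRICT-margin tetrahedral bound in the critical state at scale `l`,
`U₄^crit(l·A) ≤ -c·GG` with `c > 0`, passes to all large free boxes `Λ_N` with constant `c/2`: the free box
correlators converge to the critical state (`criticalCorr_wellDefined_holds`) and `GG > 0`. [folklore] -/
theorem boxU4Bound_of_critical {c : ℝ} (hc : 0 < c) {l : ℕ} (hl : 1 ≤ l) (h : U4crit l ≤ -(c * GGcrit l)) :
    ∃ N₀ : ℕ, ∀ N : ℕ, N₀ ≤ N → ∀ a : Fin 4 → ↥(box 3 N), (∀ i, ((a i : Site 3)) = (l : ℤ) • tetra i) →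
      connectedFour (isingMeasure ((zdGraph 3).comap (Subtype.val : ↥(box 3 N) → Site 3)) Finset.univ
          (criticalBeta 3) 0 .free) spinAt a
        ≤ -(c / 2 * isingCorr ((zdGraph 3).comap (Subtype.val : ↥(box 3 N) → Site 3)) Finset.univ
              (criticalBeta 3) 0 .free {a 0, a 1} *
            isingCorr ((zdGraph 3).comap (Subtype.val : ↥(box 3 N) → Site 3)) Finset.univ
              (criticalBeta 3) 0 .free {a 2, a 3}) := by
  have hβ : 0 ≤ criticalBeta 3 := criticalBeta_nonneg 3
  -- the free box correlators at the points `l·A`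
  set u : ℕ → ℝ := fun N => isingExpect (zdGraph 3) (box 3 N) (criticalBeta 3) 0 .free
    (spinMonomial fun i : Fin 4 => (l : ℤ) • tetra i) with hu
  set g : ℕ → Fin 4 → Fin 4 → ℝ := fun N i j => isingExpect (zdGraph 3) (box 3 N) (criticalBeta 3) 0 .free
    (spinMonomial ![(l : ℤ) • tetra i, (l : ℤ) • tetra j]) with hg
  have hwd := criticalCorr_wellDefined_holds (d := 3) le_rfl
  have hfree : (BoundaryCondition.free : BoundaryCondition (Site 3)) ∈
      ({.free, .plus, .minus} : Set (BoundaryCondition (Site 3))) := by simp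
  have hu' : Tendsto u atTop (𝓝 (criticalCorr 3 4 fun i : Fin 4 => (l : ℤ) • tetra i)) :=
    hwd 4 (fun i : Fin 4 => (l : ℤ) • tetra i) .free hfree
  have hg' : ∀ i j : Fin 4, Tendsto (fun N => g N i j) atTop (𝓝 (criticalCorr 3 2 ![(l : ℤ) • tetra i, (l : ℤ) • tetra j])) :=
    fun i j => hwd 2 ![(l : ℤ) • tetra i, (l : ℤ) • tetra j] .free hfree
  -- the margin functional converges to a negative number
  have hD : Tendsto (fun N => u N - (g N 0 1 * g N 2 3 + g N 0 2 * g N 1 3 + g N 0 3 * g N 1 2)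
      + c / 2 * (g N 0 1 * g N 2 3)) atTop (𝓝 (U4crit l + c / 2 * GGcrit l)) := by
    simp only [U4crit, GGcrit]
    exact (hu'.sub ((((hg' 0 1).mul (hg' 2 3)).add ((hg' 0 2).mul (hg' 1 3))).add ((hg' 0 3).mul (hg' 1 2)))).add
      (((hg' 0 1).mul (hg' 2 3)).const_mul (c / 2))
  have hGG : 0 < GGcrit l := mul_pos (criticalCorr_two_pos _ _) (criticalCorr_two_pos _ _)
  have hneg : U4crit l + c / 2 * GGcrit l < 0 := by nlinarith
  obtain ⟨N₁, hN₁⟩ := Filter.eventually_atTop.1 (hD.eventually (gt_mem_nhds hneg))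
  refine ⟨max N₁ l, fun N hN a ha => ?_⟩
  have hN₁N : N₁ ≤ N := le_of_max_le_left hN
  have hainj : Function.Injective a := tetra_injective hl a ha
  -- transport to the free box measure of `ℤ³` and read everything as `isingExpect` of spin monomials
  rw [isingCorr_pair_eq_twoPoint _ hβ (hainj.ne (by decide)), isingCorr_pair_eq_twoPoint _ hβ (hainj.ne (by decide)),
    connectedFour_boxComap (box 3 N) (criticalBeta 3) a, twoPoint_boxComap (box 3 N) (criticalBeta 3) (a 0) (a 1),
    twoPoint_boxComap (box 3 N) (criticalBeta 3) (a 2) (a 3)]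
  unfold connectedFour
  rw [nPoint_isingMeasure]
  simp only [twoPoint_eq_isingExpect_spinMonomial, ha]
  have key := hN₁ N hN₁N
  simp only [hu, hg] at key
  linarith

/-! ## Step 3 — per box: the landed tetrahedral sandwich (`TetraU4Lattice ⇒ crux`, constant `c/3`) -/

/-- The landed separation bound of the line `Sketch` (DepletionBound + pair split), as a closed theorem. -/
theorem separation_bound :
    ∀ (V : Type) [Fintype V] [DecidableEq V] (G : SimpleGraph V) [DecidableRel G.Adj] (β : ℝ),
      0 ≤ β → ∀ a : Fin 4 → V, Function.Injective a →
      loopO1PartitionFunction G (Real.tanh β) {a 0, a 1} * loopO1PartitionFunction G (Real.tanh β) {a 2, a 3}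
        - (∑ F₁ ∈ tJoins G Set.univ {a 0, a 1}, ∑ F₂ ∈ tJoins G Set.univ {a 2, a 3},
            if ∃ v : V, (SimpleGraph.fromEdgeSet (↑F₁ : Set (Sym2 V))).Reachable (a 0) v ∧
                (SimpleGraph.fromEdgeSet (↑F₂ : Set (Sym2 V))).Reachable (a 2) v
            then Real.tanh β ^ (F₁.card + F₂.card) else 0)
        ≤ (∑ D ∈ (tJoins G Set.univ (Finset.univ.image a)).filter (fun D : Finset (Sym2 V) =>
            ¬ (SimpleGraph.fromEdgeSet (↑D : Set (Sym2 V))).Reachable (a 0) (a 2) ∧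
            ¬ (SimpleGraph.fromEdgeSet (↑D : Set (Sym2 V))).Reachable (a 0) (a 3)),
            Real.tanh β ^ D.card) * loopO1PartitionFunction G (Real.tanh β) ∅ :=
  Summit.CriticalPhenomena.Ising3DConformalLimit.Theorems.stub_separation
    Summit.CriticalPhenomena.Ising3DConformalLimit.Theorems.depletionBound_proof
    Summit.CriticalPhenomena.Ising3DConformalLimit.Theorems.stub_pairSplit

set_option maxHeartbeats 400000 in
/-- **Per-box transfer** at one scale `l` and one box `Λ_N`: a tetrahedral `U₄` bound with constant `c` in
the box gives the crux's joint-sum inequality with constant `c/3` in the same box (landed algebra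
`StubTransfer.joint_ge_of_sep_sym_u4` + landed separation, pairing symmetry and box symmetry). [folklore] -/
theorem jointSum_ge_of_boxU4 {c : ℝ} {l N : ℕ} (hl : 1 ≤ l) (a : Fin 4 → ↥(box 3 N))
    (ha : ∀ i, ((a i : Site 3)) = (l : ℤ) • tetra i)
    (hU : connectedFour (isingMeasure ((zdGraph 3).comap (Subtype.val : ↥(box 3 N) → Site 3)) Finset.univ
          (criticalBeta 3) 0 .free) spinAt a
        ≤ -(c * isingCorr ((zdGraph 3).comap (Subtype.val : ↥(box 3 N) → Site 3)) Finset.univ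
              (criticalBeta 3) 0 .free {a 0, a 1} *
            isingCorr ((zdGraph 3).comap (Subtype.val : ↥(box 3 N) → Site 3)) Finset.univ
              (criticalBeta 3) 0 .free {a 2, a 3})) :
    c / 3 * loopO1PartitionFunction ((zdGraph 3).comap (Subtype.val : ↥(box 3 N) → Site 3))
        (Real.tanh (criticalBeta 3)) {a 0, a 1} *
      loopO1PartitionFunction ((zdGraph 3).comap (Subtype.val : ↥(box 3 N) → Site 3))
        (Real.tanh (criticalBeta 3)) {a 2, a 3} ≤
      ∑ F₁ ∈ tJoins ((zdGraph 3).comap (Subtype.val : ↥(box 3 N) → Site 3)) Set.univ {a 0, a 1},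
        ∑ F₂ ∈ tJoins ((zdGraph 3).comap (Subtype.val : ↥(box 3 N) → Site 3)) Set.univ {a 2, a 3},
          if (SimpleGraph.fromEdgeSet ((↑F₁ : Set (Sym2 ↥(box 3 N))) ∪ ↑F₂)).Reachable (a 0) (a 2)
          then Real.tanh (criticalBeta 3) ^ (F₁.card + F₂.card) else 0 := by
  have hβ : 0 ≤ criticalBeta 3 := criticalBeta_nonneg 3
  have ha' : Function.Injective a := tetra_injective hl a ha
  obtain ⟨hφ, hψ⟩ := Summit.CriticalPhenomena.Ising3DConformalLimit.Theorems.stub_boxSymmetry l N a ha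
  have hS := Summit.CriticalPhenomena.Ising3DConformalLimit.Theorems.stub_symmetry ↥(box 3 N)
    ((zdGraph 3).comap (Subtype.val : ↥(box 3 N) → Site 3)) (Real.tanh (criticalBeta 3))
    tanh_criticalBeta_nonneg a ha' hφ hψ
  have hP := separation_bound ↥(box 3 N) ((zdGraph 3).comap (Subtype.val : ↥(box 3 N) → Site 3))
    (criticalBeta 3) hβ a ha'
  -- the landed algebra; instance arguments are unified from the hypotheses (`@` + `convert`: the landed
  -- files elaborate `Decidable` instances classically, this file constructively — propositionally equal)
  have key := @Summit.CriticalPhenomena.Ising3DConformalLimit.Theorems.StubTransfer.joint_ge_of_sep_sym_u4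
    ↥(box 3 N) _ _ ((zdGraph 3).comap (Subtype.val : ↥(box 3 N) → Site 3)) _ (criticalBeta 3) c hβ a ha'
  have key2 := key (by convert hP) (by convert hS) (by convert hU)
  convert key2

/-! ## Calibration of the stubs (kernel-checked; not used by the composition)

Stub 1 is implied by the route's rank-4 crux `MoebiusLimit` (drop `Δ` and Möbius covariance); stub 2 is
implied by the crux itself (the landed `latticeBoundFromStrands_proof` + `strandsJoinBound_proof` give the
tetrahedral bound at ALL `l ≥ 1`).  So the line replaces `IndependentStrandsJoin` in `closes` by the pair
(part of `MoebiusLimit`, `TetraMergingIO`) — a genuine weakening of the rank-2 hypothesis at no cost to the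
deciding theorem. -/

/-- `MoebiusLimit → LimitExists` (forget `Δ` and the covariance). [folklore] -/
theorem limitExists_of_moebiusLimit (h : MoebiusLimit) : LimitExists := by
  obtain ⟨ρ, Δ, S, hρ, _, hlim, hnd, _⟩ := h
  exact ⟨ρ, S, hρ, hlim, hnd⟩

/-- `IndependentStrandsJoin → TetraMergingIO`: the crux gives the tetrahedral bound at every scale
(`latticeBoundFromStrands_proof` with the proved `StrandsJoinBound`), a fortiori infinitely often. [folklore] -/
theorem tetraMergingIO_of_independentStrandsJoin (h : IndependentStrandsJoin) : TetraMergingIO := by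
  obtain ⟨c, hc, hall⟩ :=
    Summit.CriticalPhenomena.Ising3DConformalLimit.FKParityRobustnessLatticeBoundFromStrands.latticeBoundFromStrands_proof
      h Summit.CriticalPhenomena.Ising3DConformalLimit.FKParityRobustnessStrandsJoinBound.strandsJoinBound_proof
  refine ⟨c, hc, fun L₀ => ⟨max L₀ 1, le_max_left _ _, ?_⟩⟩
  have := hall (max L₀ 1) (le_max_right _ _)
  simpa [U4crit, GGcrit, tetra] using this

/-! ## Composition: the crux BY NAME from the three stubs -/

/-- **The limit-upgrade composition.**  Existence of the limit (stub 1) upgrades tetrahedral far merging along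
infinitely many scales (stub 2) to all large scales `l ≥ l₁` (`tetraMergingEventually_of_io`); the
infinite-volume bound passes to large free boxes (`boxU4Bound_of_critical`) and, per box, to the crux's
joint loop-O(1) sum with constant `c/12` (`jointSum_ge_of_boxU4`); the finitely many scales `1 ≤ l < l₁`
carry their own positive constants (per-scale hypothesis); the crux's constant is the minimum. [folklore] -/
theorem independentStrandsJoin_of_limit_io :
    LimitExists → TetraMergingIO → IndependentStrandsJoinPerScale →
      Summit.CriticalPhenomena.Ising3DConformalLimit.Theses.FKParityRobustness.IndependentStrandsJoin := by
  intro hL hio hper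
  obtain ⟨c, hc, l₁, hev⟩ := tetraMergingEventually_of_io hL hio
  -- per-scale constants below `l₁`
  have hper' : ∀ l : ℕ, 1 ≤ l → ∃ c' : ℝ, 0 < c' ∧ ∃ N₀ : ℕ, ∀ N : ℕ, N₀ ≤ N → ∀ a : Fin 4 → ↥(box 3 N),
      (∀ i, ((a i : Site 3)) = (l : ℤ) • tetra i) →
      c' * loopO1PartitionFunction ((zdGraph 3).comap (Subtype.val : ↥(box 3 N) → Site 3))
          (Real.tanh (criticalBeta 3)) {a 0, a 1} *
        loopO1PartitionFunction ((zdGraph 3).comap (Subtype.val : ↥(box 3 N) → Site 3))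
          (Real.tanh (criticalBeta 3)) {a 2, a 3} ≤
        ∑ F₁ ∈ tJoins ((zdGraph 3).comap (Subtype.val : ↥(box 3 N) → Site 3)) Set.univ {a 0, a 1},
          ∑ F₂ ∈ tJoins ((zdGraph 3).comap (Subtype.val : ↥(box 3 N) → Site 3)) Set.univ {a 2, a 3},
            if (SimpleGraph.fromEdgeSet ((↑F₁ : Set (Sym2 ↥(box 3 N))) ∪ ↑F₂)).Reachable (a 0) (a 2)
            then Real.tanh (criticalBeta 3) ^ (F₁.card + F₂.card) else 0 := hper
  -- large scales: constant `c/2/3`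
  have hlarge : ∀ l : ℕ, 1 ≤ l → l₁ ≤ l → ∃ N₀ : ℕ, ∀ N : ℕ, N₀ ≤ N → ∀ a : Fin 4 → ↥(box 3 N),
      (∀ i, ((a i : Site 3)) = (l : ℤ) • tetra i) →
      c / 2 / 3 * loopO1PartitionFunction ((zdGraph 3).comap (Subtype.val : ↥(box 3 N) → Site 3))
          (Real.tanh (criticalBeta 3)) {a 0, a 1} *
        loopO1PartitionFunction ((zdGraph 3).comap (Subtype.val : ↥(box 3 N) → Site 3))
          (Real.tanh (criticalBeta 3)) {a 2, a 3} ≤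
        ∑ F₁ ∈ tJoins ((zdGraph 3).comap (Subtype.val : ↥(box 3 N) → Site 3)) Set.univ {a 0, a 1},
          ∑ F₂ ∈ tJoins ((zdGraph 3).comap (Subtype.val : ↥(box 3 N) → Site 3)) Set.univ {a 2, a 3},
            if (SimpleGraph.fromEdgeSet ((↑F₁ : Set (Sym2 ↥(box 3 N))) ∪ ↑F₂)).Reachable (a 0) (a 2)
            then Real.tanh (criticalBeta 3) ^ (F₁.card + F₂.card) else 0 := by
    intro l hl hl₁
    obtain ⟨N₀, hN₀⟩ := boxU4Bound_of_critical hc hl (hev l hl₁)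
    exact ⟨N₀, fun N hN a ha => jointSum_ge_of_boxU4 hl a ha (hN₀ N hN a ha)⟩
  -- a non-dependent choice of per-scale constants (value `1` at the unused scale `l = 0`)
  have hper'' : ∀ l : ℕ, ∃ c' : ℝ, 0 < c' ∧ (1 ≤ l → ∃ N₀ : ℕ, ∀ N : ℕ, N₀ ≤ N → ∀ a : Fin 4 → ↥(box 3 N),
      (∀ i, ((a i : Site 3)) = (l : ℤ) • tetra i) →
      c' * loopO1PartitionFunction ((zdGraph 3).comap (Subtype.val : ↥(box 3 N) → Site 3))
          (Real.tanh (criticalBeta 3)) {a 0, a 1} *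
        loopO1PartitionFunction ((zdGraph 3).comap (Subtype.val : ↥(box 3 N) → Site 3))
          (Real.tanh (criticalBeta 3)) {a 2, a 3} ≤
        ∑ F₁ ∈ tJoins ((zdGraph 3).comap (Subtype.val : ↥(box 3 N) → Site 3)) Set.univ {a 0, a 1},
          ∑ F₂ ∈ tJoins ((zdGraph 3).comap (Subtype.val : ↥(box 3 N) → Site 3)) Set.univ {a 2, a 3},
            if (SimpleGraph.fromEdgeSet ((↑F₁ : Set (Sym2 ↥(box 3 N))) ∪ ↑F₂)).Reachable (a 0) (a 2)
            then Real.tanh (criticalBeta 3) ^ (F₁.card + F₂.card) else 0) := by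
    intro l
    by_cases hl : 1 ≤ l
    · obtain ⟨c', hc', h⟩ := hper' l hl
      exact ⟨c', hc', fun _ => h⟩
    · exact ⟨1, one_pos, fun h => absurd h hl⟩
  choose cf hcf hN using hper''
  -- the crux's constant: the minimum of `c/6` and the per-scale constants at the scales `l ≤ l₁`
  have hne : (Finset.range (l₁ + 1)).Nonempty := ⟨0, by simp⟩
  set cstar : ℝ := min (c / 2 / 3) ((Finset.range (l₁ + 1)).inf' hne cf) with hcstar
  have hcstar_pos : 0 < cstar := by
    refine lt_min (by positivity) ?_
    exact (Finset.lt_inf'_iff hne).2 fun l _ => hcf l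
  have hcstar_le : cstar ≤ c / 2 / 3 := min_le_left _ _
  have hcstar_le' : ∀ l : ℕ, l ≤ l₁ → cstar ≤ cf l := fun l hl =>
    (min_le_right _ _).trans (Finset.inf'_le cf (by simpa [Nat.lt_succ_iff] using hl))
  refine ⟨cstar, hcstar_pos, fun l hl => ?_⟩
  have ht : 0 ≤ Real.tanh (criticalBeta 3) := tanh_criticalBeta_nonneg
  by_cases hl₁ : l₁ ≤ l
  · obtain ⟨N₀, hN₀⟩ := hlarge l hl hl₁
    refine ⟨N₀, fun N hNN a ha => ?_⟩
    have h := hN₀ N hNN a ha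
    have hZ : 0 ≤ loopO1PartitionFunction ((zdGraph 3).comap (Subtype.val : ↥(box 3 N) → Site 3))
          (Real.tanh (criticalBeta 3)) {a 0, a 1} *
        loopO1PartitionFunction ((zdGraph 3).comap (Subtype.val : ↥(box 3 N) → Site 3))
          (Real.tanh (criticalBeta 3)) {a 2, a 3} :=
      mul_nonneg (loopO1PartitionFunction_nonneg _ ht _) (loopO1PartitionFunction_nonneg _ ht _)
    have hmono := mul_le_mul_of_nonneg_right hcstar_le hZ
    simp only
    linarith [hmono, h]
  · push Not at hl₁
    obtain ⟨N₀, hN₀⟩ := hN l hl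
    refine ⟨N₀, fun N hNN a ha => ?_⟩
    have h := hN₀ N hNN a ha
    have hZ : 0 ≤ loopO1PartitionFunction ((zdGraph 3).comap (Subtype.val : ↥(box 3 N) → Site 3))
          (Real.tanh (criticalBeta 3)) {a 0, a 1} *
        loopO1PartitionFunction ((zdGraph 3).comap (Subtype.val : ↥(box 3 N) → Site 3))
          (Real.tanh (criticalBeta 3)) {a 2, a 3} :=
      mul_nonneg (loopO1PartitionFunction_nonneg _ ht _) (loopO1PartitionFunction_nonneg _ ht _)
    have hmono := mul_le_mul_of_nonneg_right (hcstar_le' l hl₁.le) hZ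
    simp only
    linarith [hmono, h]

end Summit.CriticalPhenomena.Ising3DConformalLimit.Theorems.IndependentStrandsJoinLimitUpgrade
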